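import Literature.Analysis.FluidPDE.SereginSverak2002LargenessOnWindows
import Literature.Analysis.FluidPDE.SereginSverak2002BlowupLargeness
import Literature.Analysis.FluidPDE.SereginSverak2002VertexBlowupLimit
import Literature.Analysis.FluidPDE.SereginSverak2002WeakVanishing
import Literature.Analysis.FluidPDE.SuitableWeakZeroExtension
import Literature.Analysis.FluidPDE.SereginSverakNoConcentration
import Literature.Analysis.FluidPDE.SereginSverak2002PressureLowerBoundProofs
import HarnessLib

/-!
# Seregin–Šverák 2002, the case of a pressure floor `p̃ ≥ -K`: no blow-up

Analysis/FluidPDE proof file (theorems only; no definitions, no named facts). The case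
"`p ≥ -g`, `g ≡ K`" of the main theorem of G. Seregin, V. Šverák, *Navier–Stokes equations with
lower bounds on the pressure*, Arch. Ration. Mech. Anal. **163** (2002) 65–86, for classical
solutions on `[0, T) × ℝ³` which are Leray–Hopf on `[0, T]` with rapidly decaying datum:

* `SereginSverak2002.isBackwardBoundedAt_top_of_floor` (`ν = 1`) — every point `(T, x₀)` of the
  final slice is regular (backward bounded);
* `SereginSverak2002.isBackwardBoundedAt_of_floor` — the same for every `ν > 0` and every
  `t₀ ∈ (0, T]` (viscosity rescaling as in `SereginSverak2002_pressureOneSidedBound.of_unitViscosity`);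
* `Literature.Analysis.FluidPDE.seregin_sverak_2002_of_floor` — **the statement of the named fact
  `seregin_sverak_2002` with the pressure-floor hypothesis** (the global `L^∞` bound on
  `(δ, T) × ℝ³`, through `farField_bound` / `nearField_bound` of `SereginSverakPressureProofs`).

The head-bounded case `|u|²/2 + p̃ ≤ K` of the fact is not treated here.

Proof of the first item, by contradiction, assembling the tree's reconstruction of §§3–4 of the
paper: if `(T, x₀)` is not backward bounded then (one-scale smallness fails, monotone scaled
energy ⇒ Type I) the probe energy is `≥ δ/2` on all final parabolic windows
(`probeEnergy_ge_on_final_windows`); the blow-up limit `w` at the vertex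
(`exists_blowup_limit_at_vertex`) inherits the *integrated* largeness on the windows
`(-ε, -ε/2) × B(0, a)` and the Morrey bound (`SereginSverak2002BlowupLargeness`); under the
pressure floor `w(s) ⇀ 0` as `s → 0⁻` (`ae_abs_pairing_le_near_top`: finite log-tangential energy at
the vertex ⇒ radial zoom limits ⇒ zero), so that its zero extension is a suitable weak solution
across `t = 0` (`ZeroExtension.isSuitableWeakSolutionOn`), and Caffarelli–Kohn–Nirenberg at the
final time forbids the concentration (`noConcentration`) — contradiction for `a` large, `η`, `ε`
small.

## References

* G. Seregin, V. Šverák, Arch. Ration. Mech. Anal. 163 (2002), 65–86. [SereginSverak2002]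
* L. Caffarelli, R. Kohn, L. Nirenberg, Comm. Pure Appl. Math. 35 (1982). [CaffarelliKohnNirenberg1982]
-/

noncomputable section

open MeasureTheory TopologicalSpace Set Function Filter Topology Metric InnerProductSpace Real
open scoped ENNReal NNReal RealInnerProductSpace ContDiff

namespace Literature.Analysis.FluidPDE

namespace SereginSverak2002

variable {T : ℝ} {u : ℝ → EuclideanSpace ℝ (Fin 3) → EuclideanSpace ℝ (Fin 3)}
  {p : ℝ → EuclideanSpace ℝ (Fin 3) → ℝ}

set_option maxHeartbeats 1600000 in
/-- **Regularity of the final slice from the weak vanishing of blow-up limits, `ν = 1`.** Under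
either one-sided pressure hypothesis: if every blow-up limit `w` of the zooms at the vertex
`(T, x₀)` (in the sense of `exists_blowup_limit_at_vertex`: `L³(Q(b))`-limit along scales
`R_j → 0⁺`) vanishes weakly at the final time (`|∫ ⟪w(s), φ⟫| ≤ η` for a.e. `s ∈ (-δ, 0)`), then
`(T, x₀)` is backward bounded. This isolates the analytic input still missing for the head-bounded
case; for the pressure floor it is `ae_abs_pairing_le_near_top`. [cite: SereginSverak2002, §4] -/
theorem isBackwardBoundedAt_top_of_weakVanishing (hT : 0 < T)
    (hsol : IsClassicalNSSolutionOn (Ico 0 T) 1 0 u p) (hLH : IsLerayHopfOn T 1 0 (u 0) u)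
    {K : ℝ} (hK : 0 ≤ K)
    (hone : (∀ t ∈ Ioo 0 T, ∀ x, ‖u t x‖ ^ 2 / 2 + normalisedPressure (u t) x ≤ K) ∨
      (∀ t ∈ Ioo 0 T, ∀ x, -K ≤ normalisedPressure (u t) x))
    (x₀ : EuclideanSpace ℝ (Fin 3))
    (hvan_all : ∀ (R : ℕ → ℝ) (w : ℝ → EuclideanSpace ℝ (Fin 3) → EuclideanSpace ℝ (Fin 3)) (b : ℝ),
      (∀ j, 0 < R j) → Tendsto R atTop (𝓝 0) → 1 ≤ b →
      MemLp (uncurry w) 3 (volume.restrict (parabolicCylinder b (0 : ℝ × EuclideanSpace ℝ (Fin 3)))) →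
      Tendsto (fun j => eLpNorm (uncurry ((R j) • stPull ((R j) ^ 2) (R j) T x₀ u) - uncurry w) 3
        (volume.restrict (parabolicCylinder b (0 : ℝ × EuclideanSpace ℝ (Fin 3))))) atTop (𝓝 0) →
      ∀ φ : EuclideanSpace ℝ (Fin 3) → EuclideanSpace ℝ (Fin 3), ContDiff ℝ (⊤ : ℕ∞) φ →
        HasCompactSupport φ → tsupport φ ⊆ ball (0 : EuclideanSpace ℝ (Fin 3)) b →
        ∀ η > 0, ∃ δ' > 0, ∀ᵐ s ∂(volume : Measure ℝ), s ∈ Ioo (-δ') 0 → |∫ x, ⟪w s x, φ x⟫| ≤ η) :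
    IsBackwardBoundedAt u T x₀ := by
  by_contra hnot
  -- the probe pair and the largeness on final windows
  obtain ⟨P, Pb, hP, hPb, hPnn, hPle, hPble, hPbpos, -, hPb1, hP0, hPb', hode⟩ := exists_pressureProbePair
  obtain ⟨δ, hδ, hL⟩ := probeEnergy_ge_on_final_windows hP hPb hode hP0 hPnn hPle hPble hPbpos hPb1 hPb'
  obtain ⟨θ, hθ, r₀, hr₀, -, hlarge⟩ := hL T u p hT hsol hLH K hK hone x₀ hnot
  -- the blow-up limit at the vertex
  obtain ⟨R, w, pL, hRpos, -, hR0, hlim⟩ := exists_blowup_limit_at_vertex hT hsol hLH hK hone x₀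
  -- the constants
  set MF : ℝ := (∫ x, ‖u 0 x‖ ^ 2) + 4 * π * K with hMF
  have hMF0 : 0 ≤ MF := by have : 0 ≤ ∫ x, ‖u 0 x‖ ^ 2 := integral_nonneg fun x => sq_nonneg _; positivity
  set a : ℝ := max 1 (Real.sqrt (8 * MF / δ)) with ha
  have ha1 : 1 ≤ a := le_max_left _ _
  have ha0 : 0 < a := by linarith
  have haMF : MF / a ^ 2 ≤ δ / 8 := by
    have h1 : Real.sqrt (8 * MF / δ) ≤ a := le_max_right _ _
    have h2 : 8 * MF / δ ≤ a ^ 2 := by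
      calc 8 * MF / δ = (Real.sqrt (8 * MF / δ)) ^ 2 := (Real.sq_sqrt (by positivity)).symm
        _ ≤ a ^ 2 := pow_le_pow_left₀ (Real.sqrt_nonneg _) h1 2
    rw [div_le_iff₀ (by positivity)]
    rw [div_le_iff₀ hδ] at h2
    nlinarith
  set b : ℝ := a + 2 with hb
  have hb0 : 0 < b := by linarith
  have hb1 : 1 ≤ b := by linarith
  -- the limit on `Q(b)`
  obtain ⟨hswB, hw3, hconv, -⟩ := hlim b hb0
  obtain ⟨hsw, hE, hG, hP32⟩ := hswB
  -- weak vanishing at the final time and the zero extension on the box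
  have hvan : ∀ φ : EuclideanSpace ℝ (Fin 3) → EuclideanSpace ℝ (Fin 3), ContDiff ℝ (⊤ : ℕ∞) φ →
      HasCompactSupport φ → tsupport φ ⊆ ball (0 : EuclideanSpace ℝ (Fin 3)) b →
      ∀ η > 0, ∃ δ' > 0, ∀ᵐ s ∂(volume : Measure ℝ), s ∈ Ioo (-δ') 0 → |∫ x, ⟪w s x, φ x⟫| ≤ η :=
    fun φ hφ hφc hφa η hη => hvan_all R w b hRpos hR0 hb1 hw3 hconv φ hφ hφc hφa η hη
  have hzero : (0 : ℝ × EuclideanSpace ℝ (Fin 3)) = ((0 : ℝ), (0 : EuclideanSpace ℝ (Fin 3))) := rfl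
  have hE' : ∃ C : ℝ≥0, ∀ᵐ t ∂(volume.restrict (Ioo (-b ^ 2) 0)),
      ∫⁻ x in ball (0 : EuclideanSpace ℝ (Fin 3)) b, ‖w t x‖ₑ ^ 2 ≤ C := by
    simpa [hzero] using hE
  have hbox := ZeroExtension.isSuitableWeakSolutionOn (U := w) (P := pL) (x₀ := (0 : EuclideanSpace ℝ (Fin 3)))
    hb0 (by rw [← hzero]; exact hsw) hE' (by rw [← hzero]; exact hG) (by rw [← hzero]; exact hw3)
    (by rw [← hzero]; exact hP32) hvan
  -- the Morrey bound and the integrability of the limit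
  have hMorrey : ∀ (y : EuclideanSpace ℝ (Fin 3)) (ρ : ℝ), 0 < ρ → ∀ s₁ s₂ : ℝ, s₁ < s₂ → s₂ < 0 →
      Ioo s₁ s₂ ×ˢ ball y ρ ⊆ parabolicCylinder b (0 : ℝ × EuclideanSpace ℝ (Fin 3)) →
      ∫ z in Ioo s₁ s₂ ×ˢ ball y ρ, ‖w z.1 z.2‖ ^ 2 ≤ (s₂ - s₁) * ((2 * MF) * ρ) := by
    intro y ρ hρ s₁ s₂ h12 hs₂ hS
    have h := blowupLimit_window_ball_le hT hsol hLH hK hone x₀ hRpos hR0 hw3 hconv hρ y h12 hs₂ hS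
    simpa [hMF, mul_assoc] using h
  have hfinQ : volume (parabolicCylinder b (0 : ℝ × EuclideanSpace ℝ (Fin 3))) < ⊤ := by
    rw [parabolicCylinder]
    exact ((isCompact_Icc.prod (isCompact_closedBall _ _)).measure_lt_top).trans_le'
      (measure_mono (prod_mono Ioo_subset_Icc_self ball_subset_closedBall))
  haveI : IsFiniteMeasure (volume.restrict (parabolicCylinder b (0 : ℝ × EuclideanSpace ℝ (Fin 3)))) :=
    ⟨by rw [Measure.restrict_apply_univ]; exact hfinQ⟩
  have hw2mem : MemLp (uncurry w) 2 (volume.restrict (parabolicCylinder b (0 : ℝ × EuclideanSpace ℝ (Fin 3)))) :=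
    hw3.mono_exponent (by norm_num)
  have hw2 : IntegrableOn (fun z : ℝ × EuclideanSpace ℝ (Fin 3) => ‖w z.1 z.2‖ ^ 2)
      (parabolicCylinder b (0 : ℝ × EuclideanSpace ℝ (Fin 3))) :=
    hw2mem.integrable_norm_pow two_ne_zero
  -- the threshold `η` and no concentration
  set VB : ℝ := volume.real (ball (0 : EuclideanSpace ℝ (Fin 3)) a) with hVB
  have hVB0 : 0 ≤ VB := measureReal_nonneg
  set η : ℝ := min 1 (δ / (8 * (2 * MF + VB + 1))) with hη
  have hη0 : 0 < η := lt_min one_pos (by positivity)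
  have hη1 : η ≤ 1 := min_le_left _ _
  have hηsmall : 2 * MF * η + η ^ 2 * VB ≤ δ / 8 := by
    have h1 : η ≤ δ / (8 * (2 * MF + VB + 1)) := min_le_right _ _
    have h2 : η ^ 2 * VB ≤ η * VB := by
      have : η ^ 2 ≤ η := by nlinarith
      exact mul_le_mul_of_nonneg_right this hVB0
    have h3 : η * (2 * MF + VB + 1) ≤ δ / 8 := by
      rw [le_div_iff₀ (by positivity)] at h1
      linarith
    nlinarith
  obtain ⟨ε₀, hε₀, hF⟩ := noConcentration (w := w) (q := pL) ha0 (le_refl (a + 2)) hbox (by positivity : (0 : ℝ) ≤ 2 * MF)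
    hMorrey hw2 hη0
  -- the window `(-ε, -ε/2)`
  set ε : ℝ := min (min ε₀ 1) (θ ^ 2) with hε
  have hε0 : 0 < ε := lt_min (lt_min hε₀ one_pos) (by positivity)
  have hεε₀ : ε ≤ ε₀ := (min_le_left _ _).trans (min_le_left _ _)
  have hε1 : ε ≤ 1 := (min_le_left _ _).trans (min_le_right _ _)
  have hεθ : ε ≤ θ ^ 2 := min_le_right _ _
  have hwin : Ioo (-ε) (-ε / 2) ×ˢ ball (0 : EuclideanSpace ℝ (Fin 3)) a ⊆
      parabolicCylinder b (0 : ℝ × EuclideanSpace ℝ (Fin 3)) := by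
    rw [parabolicCylinder]
    refine prod_mono (Ioo_subset_Ioo ?_ ?_) (ball_subset_ball (by linarith))
    · simp only [Prod.fst_zero]
      nlinarith
    · simp only [Prod.fst_zero]
      linarith
  -- lower bound (largeness of the limit) against upper bound (no concentration)
  have hlow := blowupLimit_window_probe_ge hP hPb hode hP0 hPnn hPle hPble hPbpos hPb' hT hsol hLH hK hone
    x₀ hr₀ hlarge hRpos hR0 hw3 hconv ha1 (by linarith : -θ ^ 2 ≤ -ε) (by linarith : -ε < -ε / 2)
    (by linarith : -ε / 2 < 0) hwin
  have hup := hF ε hε0 hεε₀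
  have hPb_le : ∫ z in Ioo (-ε) (-ε / 2) ×ˢ ball (0 : EuclideanSpace ℝ (Fin 3)) a, ‖w z.1 z.2‖ ^ 2 * Pb (‖z.2‖ ^ 2) ≤
      ∫ z in Ioo (-ε) (-ε / 2) ×ˢ ball (0 : EuclideanSpace ℝ (Fin 3)) a, ‖w z.1 z.2‖ ^ 2 := by
    have hint := hw2.mono_set hwin
    refine integral_mono_of_nonneg (Eventually.of_forall fun z => mul_nonneg (sq_nonneg _) ((hPnn _).trans (hPle _)))
      hint (Eventually.of_forall fun z => ?_)
    exact mul_le_of_le_one_right (sq_nonneg _) (hPble _)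
  have e1 : (-ε / 2 - -ε) = ε / 2 := by ring
  rw [e1] at hlow
  have hchain : (ε / 2) * (δ / 2 - MF / a ^ 2) ≤ (ε / 2) * (2 * MF * η + η ^ 2 * VB) :=
    hlow.trans (hPb_le.trans hup)
  have hcontra : δ / 2 - MF / a ^ 2 ≤ 2 * MF * η + η ^ 2 * VB := le_of_mul_le_mul_left hchain (by positivity)
  linarith

/-- **Regularity of the final slice under a pressure floor, `ν = 1`.** For a classical solution on
`[0, T) × ℝ³` which is Leray–Hopf on `[0, T]`, with `p̃ ≥ -K`: every `(T, x₀)` is backward bounded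
(the blow-up limits vanish weakly at the final time by `ae_abs_pairing_le_near_top`).
[cite: SereginSverak2002, Main Theorem, case p ≥ -g] -/
theorem isBackwardBoundedAt_top_of_floor (hT : 0 < T)
    (hsol : IsClassicalNSSolutionOn (Ico 0 T) 1 0 u p) (hLH : IsLerayHopfOn T 1 0 (u 0) u)
    {K : ℝ} (hK : 0 ≤ K) (hfloor : ∀ t ∈ Ioo 0 T, ∀ x, -K ≤ normalisedPressure (u t) x)
    (x₀ : EuclideanSpace ℝ (Fin 3)) : IsBackwardBoundedAt u T x₀ :=
  isBackwardBoundedAt_top_of_weakVanishing hT hsol hLH hK (Or.inr hfloor) x₀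
    fun _ _ _ hRpos hR0 hb hw3 hconv _ hφ hφc hφa _ hη =>
      ae_abs_pairing_le_near_top hT hsol hLH hK hfloor x₀ hRpos hR0 hb hw3 hconv hφ hφc hφa hη

/-- **Regularity under a pressure floor, every viscosity and every time** `t₀ ∈ (0, T]`
(viscosity rescaling to `ν = 1`; interior times by continuity).
[cite: SereginSverak2002, Main Theorem, case p ≥ -g] -/
theorem isBackwardBoundedAt_of_floor {ν : ℝ} (hν : 0 < ν) (hT : 0 < T)
    (hsol : IsClassicalNSSolutionOn (Ico 0 T) ν 0 u p) (hLH : IsLerayHopfOn T ν 0 (u 0) u)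
    {K : ℝ} (hfloor : ∀ t ∈ Ioo 0 T, ∀ x, -K ≤ normalisedPressure (u t) x)
    {t₀ : ℝ} (ht₀ : t₀ ∈ Ioc 0 T) (x₀ : EuclideanSpace ℝ (Fin 3)) : IsBackwardBoundedAt u t₀ x₀ := by
  -- interior times: continuity
  rcases lt_or_eq_of_le ht₀.2 with hlt | rfl
  · exact IsBackwardBoundedAt.of_continuousOn (continuousOn_uncurry hsol) ⟨ht₀.1, hlt⟩ x₀
  -- the final time: rescale to viscosity one
  have hν0 : ν ≠ 0 := hν.ne'
  have hνi : 0 < ν⁻¹ := inv_pos.2 hν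
  have hνT : 0 < ν * t₀ := mul_pos hν hT
  set v : ℝ → EuclideanSpace ℝ (Fin 3) → EuclideanSpace ℝ (Fin 3) := timeRescale ν⁻¹ ν⁻¹ u with hv
  set π' : ℝ → EuclideanSpace ℝ (Fin 3) → ℝ := timeRescale ν⁻¹ (ν⁻¹ ^ 2) p with hπ
  have hslice : ∀ s, v s = ν⁻¹ • u (ν⁻¹ * s) := fun s => rfl
  have hmaps : MapsTo (fun s => ν⁻¹ * s) (Ico 0 (ν * t₀)) (Ico 0 t₀) := by
    intro s hs'
    refine ⟨mul_nonneg hνi.le hs'.1, ?_⟩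
    calc ν⁻¹ * s < ν⁻¹ * (ν * t₀) := mul_lt_mul_of_pos_left hs'.2 hνi
      _ = t₀ := by rw [← mul_assoc, inv_mul_cancel₀ hν0, one_mul]
  have hs' : IsClassicalNSSolutionOn (Ico 0 (ν * t₀)) 1 0 v π' := by
    have := hsol.viscosityRescale_set hν0 hmaps (uniqueDiffOn_Ico 0 (ν * t₀))
    rwa [timeRescale_zero_force] at this
  have hv0 : v 0 = ν⁻¹ • u 0 := by rw [hslice, mul_zero]
  have hLH' : IsLerayHopfOn (ν * t₀) 1 0 (v 0) v := by
    have := hLH.viscosityRescale hνi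
    rw [div_inv_eq_mul, mul_comm t₀ ν, inv_mul_cancel₀ hν0, timeRescale_zero_force] at this
    rwa [hv0]
  have hpress : ∀ s x, normalisedPressure (v s) x = ν⁻¹ ^ 2 * normalisedPressure (u (ν⁻¹ * s)) x :=
    fun s x => by rw [hslice, normalisedPressure_smul]
  -- the floor rescales (with a nonnegative constant)
  have hfloor' : ∀ s ∈ Ioo 0 (ν * t₀), ∀ x, -(ν⁻¹ ^ 2 * |K|) ≤ normalisedPressure (v s) x := by
    intro s hs'' x
    have ht : ν⁻¹ * s ∈ Ioo 0 t₀ := (inv_mul_mem_Ioo_iff hν).2 hs''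
    have h1 := hfloor _ ht x
    have h2 : -|K| ≤ normalisedPressure (u (ν⁻¹ * s)) x := (neg_le_neg (le_abs_self K)).trans h1
    have := mul_le_mul_of_nonneg_left h2 (sq_nonneg ν⁻¹)
    rw [hpress]
    linarith
  have hb := isBackwardBoundedAt_top_of_floor hνT hs' hLH' (by positivity : (0 : ℝ) ≤ ν⁻¹ ^ 2 * |K|) hfloor' x₀
  -- transport back: radius `r / max 1 ν`
  obtain ⟨r, hr, C, hC⟩ := hb
  set m : ℝ := max 1 ν with hm
  have hm1 : 1 ≤ m := le_max_left _ _
  have hmν : ν ≤ m := le_max_right _ _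
  have hm0 : 0 < m := by positivity
  refine ⟨r / m, by positivity, ν * C, fun t ht x hx => ?_⟩
  have hrm : r / m ≤ r := div_le_self hr.le hm1
  have hts : ν * t ∈ Ioo (ν * t₀ - r ^ 2) (ν * t₀) := by
    constructor
    · have h1 : ν * (t₀ - t) < ν * (r / m) ^ 2 := mul_lt_mul_of_pos_left (by linarith [ht.1]) hν
      have hsq : ν * (r / m) ^ 2 ≤ r ^ 2 := by
        rw [div_pow]
        have hm2 : ν ≤ m ^ 2 := hmν.trans (by nlinarith)
        calc ν * (r ^ 2 / m ^ 2) = ν / m ^ 2 * r ^ 2 := by ring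
          _ ≤ 1 * r ^ 2 := by
              refine mul_le_mul_of_nonneg_right ?_ (sq_nonneg r)
              rw [div_le_one (by positivity)]; exact hm2
          _ = r ^ 2 := one_mul _
      nlinarith
    · exact mul_lt_mul_of_pos_left ht.2 hν
  have hxs : x ∈ ball x₀ r := ball_subset_ball hrm hx
  have key := hC (ν * t) hts x hxs
  rw [hslice, Pi.smul_apply, ← mul_assoc, inv_mul_cancel₀ hν0, one_mul, norm_smul,
    Real.norm_eq_abs, abs_of_pos hνi] at key
  exact (inv_mul_le_iff₀ hν).1 key

/-- **Seregin–Šverák 2002 under a pressure floor** — the statement of the named fact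
`Literature.Analysis.FluidPDE.seregin_sverak_2002` with the hypothesis `p̃ ≥ -K` (the first of its
two alternatives is not covered): a classical solution on `[0, T) × ℝ³` which is Leray–Hopf on
`[0, T]` with rapidly decaying datum and `p̃(t, x) ≥ -K` stays bounded on `(δ, T) × ℝ³` for every
`δ ∈ (0, T)`. [cite: SereginSverak2002, Main Theorem, case p ≥ -g] -/
theorem _root_.Literature.Analysis.FluidPDE.seregin_sverak_2002_of_floor :
    ∀ (ν T : ℝ), 0 < ν → 0 < T →
    ∀ (u : ℝ → EuclideanSpace ℝ (Fin 3) → EuclideanSpace ℝ (Fin 3)) (p : ℝ → EuclideanSpace ℝ (Fin 3) → ℝ),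
      IsClassicalNSSolutionOn (Ico 0 T) ν 0 u p →
      IsLerayHopfOn T ν 0 (u 0) u →
      HasRapidSpatialDecay (u 0) →
      (∃ K : ℝ, ∀ t ∈ Ioo 0 T, ∀ x, -K ≤ normalisedPressure (u t) x) →
      ∀ δ ∈ Ioo 0 T, ∃ M : ℝ, ∀ t ∈ Ioo δ T, ∀ x, ‖u t x‖ ≤ M := by
  intro ν T hν hT u p hsol hLH _ hfloor δ hδ
  obtain ⟨K, hK⟩ := hfloor
  have hloc : ∀ x₀ : EuclideanSpace ℝ (Fin 3), IsBackwardBoundedAt u T x₀ := fun x₀ =>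
    isBackwardBoundedAt_of_floor hν hT hsol hLH hK ⟨hT, le_rfl⟩ x₀
  obtain ⟨R, M₁, hfar⟩ := farField_bound hν hT hsol hLH hδ.1
  obtain ⟨M₂, hnear⟩ := nearField_bound hT (continuousOn_uncurry hsol) hloc hδ.1 R
  refine ⟨max M₁ M₂, fun t ht x => ?_⟩
  by_cases hx : ‖x‖ ≤ R
  · exact (hnear (t, x) ⟨⟨ht.1.le, ht.2.le⟩, mem_closedBall_zero_iff.2 hx⟩ ht.2).trans (le_max_right _ _)
  · exact (hfar t ht x (not_le.1 hx)).trans (le_max_left _ _)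

end SereginSverak2002

end Literature.Analysis.FluidPDE

end
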